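import Summits.KontsevichZagierPeriods.KontsevichZagierPeriods.Theses.FermatIsogeny
import Summits.KontsevichZagierPeriods.KontsevichZagierPeriods.Theorems.SymplecticScissorsRealOnePeriodRelationsConditional
import Summits.KontsevichZagierPeriods.KontsevichZagierPeriods.Theorems.RealOnePeriodRelations.Negative.Kit
import Literature.NumberTheory.Transcendental.CurvePeriods
import Literature.NumberTheory.Transcendental.KZCalculus

/-!
# `BetaLinearSector` (stmt-KontsevichZagierPeriods-3897, route FermatIsogeny, crux rank 3) — line `hw-real-transport`

Crux (fixed, concluded BY NAME below): for positive rationals `a b a' b'` and a real algebraic `c`, two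
one-dimensional representations pinned on `(0,1)` as `[t^{a-1}(1-t)^{b-1}]` and `[c·t^{a'-1}(1-t)^{b'-1}]`
with the same value are KZ-equivalent (Conjecture 1 on the beta-LINEAR sector, all levels at once).

LINE (strategist, alternative to `Lines/birth.lean`; lens = TRANSFER from the solved sibling step
`SymplecticScissors.RealOnePeriodRelations`, stmt-10042). Two registered stubs and a sorry-free composition:

* `stub_huberWustholzCurvePeriods : HuberWustholzCurvePeriods` — the Literature NAMED FACT Huber–Wüstholz 2022,
  Thm 13.3 (2) (Kontsevich's period conjecture for periods of CURVE TYPE: every vanishing `ℚ̄`-combination of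
  symbols `(Z, ω, γ)` on smooth affine curves is a `ℚ̄`-combination of the elementary relations (R1)–(R5)).
  It is the SAME apex stub as line `nash-retraction-thin-strip` of `RealOnePeriodRelations` and as the lines of
  `PlanarK0Injective` / `CurvePeriodsTransfer`; proved in the tree on the sectors genus 0 (Baker), non-CM elliptic
  loops/paths and isogeny classes of a non-CM curve (`CurvePeriods.huberWustholzCurvePeriods_of_*`), NOT on the
  Fermat/CM sector this crux lives in (that needs Wüstholz's analytic subgroup theorem for the CM factors of
  `J(F_N)`, i.e. Wolfart–Wüstholz 1985 — the tree has the AST for `𝔾ₐ × 𝔾ₘ^ι × ∏E` only).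
* `stub_greenInRelations : greenSet ⊆ KZ.relations` — every instance of the typed GREEN GENERATOR of stmt-10042
  (`Theorems/RealOnePeriodRelations/Negative/Kit.lean`: `[∫A(t,0)] + [∫(B−A)(1−t,t)] − [∫B(0,t)]` for `A da + B db`
  exact on the open standard triangle, `A, B` continuous `ℚ`-semialgebraic on the closed one) is a chain of moves:
  rule 3 along `b` with `A` as its own primitive, the swap (rule 2), rule 3 along `a` with `B`, common bulk
  `∂_b A = ∂_a B` a.e. (Schwarz on the smooth strata). VERBATIM the registered stub `stub_greenInRelations` of line
  `green-native-bands` of crux `PlanarAreas` (stmt-4990), where 5 of its 7 sub-stubs are landed theorems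
  (`SymplecticScissorsPlanarAreasStub{AreaSlicing,DerivIntegrable,FibreDerivSemialgebraic,MixedPartials,Swap}`).

COMPOSITION (`BetaLinearSector_of_subs`, sorry-free, ten lines): the LANDED conditional composition of stmt-10042,
`realOnePeriodRelations_of_huberWustholzCurvePeriods : HuberWustholzCurvePeriods → RealOnePeriodRelations`
(`Theorems/SymplecticScissorsRealOnePeriodRelationsConditional.lean`: Puiseux/étale normalisation of arbitrary
one-dimensional representations into curve-type symbols, Huber–Wüstholz, and the Θ-retraction of (R1)–(R5) into
`M₁ = closure (1a ∪ 1b ∪ 2 ∪ Green)` — all landed), applied to `c = [r] − [r'] ∈ H₁` (two one-dimensional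
representations) with `eval c = r.value − r'.value = 0`, gives `c ∈ M₁`, and `M₁ ≤ relations` by the Green stub.
Nothing of the beta shape is used: the line proves Conjecture 1 for EVERY pair of one-dimensional representations
with equal values from the two stubs, in particular the crux (and, given its value identity, the route's rank-2
`IsogenyLinearNinth`). What this transfer REPLACES: the birth line's value stub (Wolfart–Wüstholz at level `N`,
Hodge vectors) is inside HW 13.3 (2); its move stub (every Koblitz–Rohrlich coincidence realised by an explicit
compiled correspondence, uniformly in `N` — "the research content of the route") is inside the landed
Θ-transport of HW's functoriality relations: no divisor on `F_N × F_N` is ever written down.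

Disproof used: none on file (no `Cruxes/BetaLinearSector/Disproof.lean`; `ledger negatives`: nothing on beta pairs).
Dead lines: none on file. All statements over existing declarations.
-/

noncomputable section

set_option linter.dupNamespace false

namespace Summit.KontsevichZagierPeriods.KontsevichZagierPeriods.Cruxes.BetaLinearSector.HwRealTransport

open Literature.NumberTheory.Transcendental
open Summit.KontsevichZagierPeriods.SymplecticScissors.RealOnePeriodRelationsNegative (greenSet M₁ H₁ crux_iff)
open Summit.KontsevichZagierPeriods.KontsevichZagierPeriods.Theses.FermatIsogeny (BetaLinearSector)

/-! ## The two registered stubs -/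

/-- Stub 1 (APEX, TRANSCENDENCE + MOTIVIC GENERATION): Huber–Wüstholz 2022, Thm 13.3 (2) — Kontsevich's period
conjecture for periods of curve type, as the tree's named fact `HuberWustholzCurvePeriods`
(`Literature/NumberTheory/Transcendental/CurvePeriods.lean`). Shared apex with `RealOnePeriodRelations`
(stmt-10042). Size XL (its Fermat sector is Wolfart–Wüstholz 1985 + the analytic subgroup theorem for CM abelian
varieties). [cite: HuberWustholz2022, Thm 13.3 (2)] -/
theorem stub_huberWustholzCurvePeriods :
    Literature.NumberTheory.Transcendental.HuberWustholzCurvePeriods := by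
  sorry

/-- Stub 2 (CALCULUS, Green is three moves on the native band): every instance of the typed Green generator of
stmt-10042 lies in `KZ.relations`. Verbatim the registered stub of line `green-native-bands` of crux `PlanarAreas`
(stmt-4990). Size L. [cite: KontsevichZagier2001, §1.2 rule (3)] -/
theorem stub_greenInRelations :
    ∀ g ∈ Summit.KontsevichZagierPeriods.SymplecticScissors.RealOnePeriodRelationsNegative.greenSet,
      g ∈ Literature.NumberTheory.Transcendental.KZ.relations := by
  sorry

/-! ## The composition (sorry-free) -/

/-- `M₁ = closure (1a ∪ 1b ∪ 2 ∪ Green) ≤ KZ.relations` as soon as the Green generator lies in the relations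
(the three other generator sets are move sets). [cite: KontsevichZagier2001, §1.2] -/
theorem M₁_le_relations
    (hG : ∀ g ∈ Summit.KontsevichZagierPeriods.SymplecticScissors.RealOnePeriodRelationsNegative.greenSet,
      g ∈ Literature.NumberTheory.Transcendental.KZ.relations) :
    M₁ ≤ KZ.relations := by
  refine (AddSubgroup.closure_le _).mpr ?_
  rintro c (((hc | hc) | hc) | hc)
  · exact KZ.domainAddRel_subset_relations hc
  · exact KZ.integrandAddRel_subset_relations hc
  · exact KZ.changeOfVariablesRel_subset_relations hc
  · exact hG c hc

/-- **Conjecture 1 for ALL pairs of one-dimensional representations, from the two stubs**: Huber–Wüstholz for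
curve-type periods gives `RealOnePeriodRelations` (landed composition of stmt-10042), so `[r] − [r'] ∈ M₁` whenever
`r.value = r'.value`; and `M₁ ≤ relations` by the Green stub. [cite: HuberWustholz2022, Thm 13.3 (2)] -/
theorem equivalent_of_value_eq
    (hHW : Literature.NumberTheory.Transcendental.HuberWustholzCurvePeriods)
    (hG : ∀ g ∈ Summit.KontsevichZagierPeriods.SymplecticScissors.RealOnePeriodRelationsNegative.greenSet,
      g ∈ Literature.NumberTheory.Transcendental.KZ.relations)
    (r r' : KZ.IntegralRep 1) (hv : r.value = r'.value) : KZ.Equivalent r r' := by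
  have hR := (crux_iff.mp
    (Summit.KontsevichZagierPeriods.SymplecticScissors.RealOnePeriodRelations.realOnePeriodRelations_of_huberWustholzCurvePeriods
      hHW))
  have hmem : KZ.of r - KZ.of r' ∈ H₁ :=
    H₁.sub_mem (AddSubgroup.subset_closure ⟨r, rfl⟩) (AddSubgroup.subset_closure ⟨r', rfl⟩)
  have heval : KZ.eval (KZ.of r - KZ.of r') = 0 := by
    rw [map_sub, KZ.eval_of, KZ.eval_of, hv, sub_self]
  exact M₁_le_relations hG (hR _ hmem heval)

/-- **The composition, arrow form**: stub₁-statement → stub₂-statement → the crux `BetaLinearSector`.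
[cite: HuberWustholz2022, Thm 13.3 (2)] -/
theorem BetaLinearSector_of_subs :
    Literature.NumberTheory.Transcendental.HuberWustholzCurvePeriods →
    (∀ g ∈ Summit.KontsevichZagierPeriods.SymplecticScissors.RealOnePeriodRelationsNegative.greenSet,
      g ∈ Literature.NumberTheory.Transcendental.KZ.relations) →
    BetaLinearSector := by
  intro hHW hG a b a' b' c _ _ _ _ _ r r' _ _ _ _ hv
  exact equivalent_of_value_eq hHW hG r r' hv

/-- **Skeleton theorem** (concludes the crux BY NAME): `BetaLinearSector` from the two declared stubs. -/
theorem BetaLinearSector_of : BetaLinearSector :=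
  BetaLinearSector_of_subs stub_huberWustholzCurvePeriods stub_greenInRelations

end Summit.KontsevichZagierPeriods.KontsevichZagierPeriods.Cruxes.BetaLinearSector.HwRealTransport

end
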